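import Literature.MathematicalPhysics.QuantumFieldTheory.Balaban1983to89.B11Eq44COperatorTorus
import Literature.MathematicalPhysics.QuantumFieldTheory.Balaban1983to89.B9Eq379QLipschitzGeneral
import Literature.MathematicalPhysics.QuantumFieldTheory.Balaban1983to89.B11Eq111FrakG

/-!
# `Balaban1983to89.B11Eq44COperatorTwoBackgrounds` — T. Bałaban, *The variational problem and background fields in renormalization group method
# for lattice gauge theories*, Commun. Math. Phys. **102** (1985) 277–309 [Balaban1985Variational] Sect. C (44), (47)–(52) p. 285 with
# [Balaban1985Averaging] Proposition 3 (121)–(123) p. 36 and Proposition 7 p. 43: THE SECT. C LETTER `C` OF (44) — THE NONLINEAR PART OF THE ONE-STEP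
# AVERAGING — IS LIPSCHITZ IN THE BACKGROUND BETWEEN TWO SMALL-BOND BACKGROUNDS `U`, `U′` of a fixed lattice: `‖C_U(Y) − C_{U′}(Y)‖_(−0) ≤ K_C·δ·‖Y‖_(115)`
# on `‖Y‖ < 1∕(512(d+1))` for `‖U(b)U′(b)⁻¹ − 1‖ ≤ δ` — the modulus `δ_C` DISPLAYED by `B11Eq174ChartContinuityAtFlat` ∕ `…TwoBackgrounds`, PRODUCED

statement-level skeleton of published theorems with citation tags; proofs where landed; nothing here is a claim about the Yang–Mills mass gap

PDF held: `paper:balaban1985-cmp102-variational-background` p. 285 (44)–(52); [4] = `paper:balaban1985-cmp98-averaging` pp. 36, 43 — through the verbatim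
quotations of `B11Eq44COperatorTorus` (the letter `C` = `Cblock` ∕ `Cc`) and `B7Prop7OneStep` (Prop. 7: *«the function Q_k(U′U₀, ηA) is analytic in complex
variables A′, A, and Proposition 4 holds uniformly in A′»* — analyticity IN THE BACKGROUND variable `A′` is what a Lipschitz bound in `U` is the Cauchy
estimate of).

CITATION HEADER (lean-in-tree rule 2026-08-18).  Audit cell `pub-balaban`, sub-cell `t4`, NE9 crux team (2): LEAF PROVER 04
(`b2b-balaban-t4-ne9-formalise-leaf-04` gen 73).  Inputs BY NAME: this lineage's (G) `B9Eq379QLipschitzGeneral.norm_Qcov_sub_Qcov_le` (the nonlinear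
one-step averaging between two backgrounds, Cauchy route on Prop. 7) and `norm_linQcov_sub_linQcov_le` (its linear part); `B11Eq44COperatorTorus.Cblock_apply`,
`equiv_Cc_apply`, `norm_perCfg_smul_le`, `eta_mul_norm_le_of_weight`; `B7Prop3GeneralLinear.Ccov` (`= Qcov − linQcov`).

WHAT IS PROVED (sorry-free; no `Prop` placeholder; no inequality of the paper asserted).
* §1 **`norm_Cblock_sub_Cblock_le`** — at a coarse bond: for the base `U′` (unit-bounded extension, `α′ ≤ 1∕128`-regular extended block loops) and `U` with
  `‖U(b)U′(b)⁻¹ − 1‖ ≤ δ ≤ 1∕(12288N)` (`N = 2dL + 2L`), `η·sup‖A‖ ≤ a ≤ c₃(d,L)∕4`: `‖Cblock U A c − Cblock U′ A c‖ ≤ 150994944·(d+1)·L·N·δ·a`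
  (`Cblock = Qcov − linQcov` of the extensions; (G) §2 + §3).
* §2 **`norm_Cc_sub_Cc_le`** — at the carrier, for two (115) spaces with ANY derivative letters `∇`, `∇′` and two elements `Y`, `Y′` with the same underlying
  configuration (e.g. `Y′ = ι Y`), `1 ≤ lev₀`, `‖Y‖ < 1∕(512(d+1))`: `‖Cc U … ∇ … Y − Cc U′ … ∇′ … Y′‖_(−0) ≤ 150994944·(d+1)·N·δ·‖Y‖`;
  **`norm_Cc_sub_Cc_jetId_le`** — the case `Y′ = ι_{∇_U→∇_{U′}} Y`; **`sectC_modulus_twoBackgrounds`** — the `δ_C`-slot of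
  `B11Eq174ChartContinuityTwoBackgrounds.exists_chartHB_lipschitz_twoBackgrounds` verbatim: `ε_C + a_C ≤ 1∕(512(d+1)) ⇒ ∀ P, ‖P‖ < ε_C + a_C →
  ‖Cc U P − Cc U′ (ιP)‖ ≤ 150994944(d+1)N·δ·(ε_C + a_C)`.
MODEL / HONEST SCOPE.  The one-level periodic model of `B9Eq315QTorus` ∕ `B11Eq44COperatorTorus` ((M1)–(M5) there); crude explicit constants from the
Cauchy route (finite-lattice through `N = 2dL + 2L` only — no `#bonds`, no `η`); the closeness is the multiplicative letter `‖U(b)U′(b)⁻¹ − 1‖ ≤ δ` of (G)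
(from `‖U(b) − U′(b)‖ ≤ δ` for unit-bounded `U′` by (G) §6); NOT print's statement (print has no two-background `C`-modulus: it is the cell's reading of
Prop. 7's analyticity in `A′`); NOT summit progress (cell pub-balaban: NE9 NOT PRINTED ∕ NOT PROVED; spine PROVED 0∕9; rung (B)+1 finite T⁴ — NOT infinite
volume, NOT mass gap, NOT BetaPertH, NOT Clay).  NEW file importing `B11Eq44COperatorTorus`, `B9Eq379QLipschitzGeneral`, `B11Eq111FrakG`; nothing modified.
Net new unproved facts: 0.
-/

noncomputable section

namespace Literature.MathematicalPhysics.QuantumFieldTheory.Balaban1983to89.B11Eq44COperatorTwoBackgrounds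

open B11Eq115Space B11Eq111FrakG
open B9SectCLatticeCarrier (Bond)
open B4Sect5Torus (TSite)
open B7Prop1Explicit (U1 Wcx boxVec)
open B7Prop3Flat (c3)
open B7Prop3GeneralLinear (Ccov Qcov linQcov)
open B9Eq319QprimeTorus (fineP)
open B9Eq315QTorus (perCfg cornerSite)
open B11Eq44COperatorTorus (Cblock Cblock_apply Cc equiv_Cc_apply norm_perCfg_smul_le eta_mul_norm_le_of_weight)
open B9Eq379QLipschitzGeneral (norm_Qcov_sub_Qcov_le norm_linQcov_sub_linQcov_le)

variable {d : ℕ} {𝔸 : Type*} [NormedRing 𝔸] [NormedAlgebra ℂ 𝔸] [CompleteSpace 𝔸] [NormOneClass 𝔸]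
  (L : ℕ) (m : Fin d → ℕ) [∀ i, NeZero (fineP L m i)] (η : ℝ) (U U' : Bond d (fineP L m) → 𝔸ˣ) (hL : 1 ≤ L)
  {α' : ℝ} (hα' : α' ≤ 1 / 128)
  (hU1' : ∀ (x : B7Prop1Explicit.Site d) (κ : Fin d), perCfg (fineP L m) U' x κ ∈ U1 𝔸)
  (hreg' : ∀ (y : TSite d m) (κ : Fin d) (r : Fin d → Fin L),
    ‖((Wcx L (perCfg (fineP L m) U') (cornerSite L y) κ (boxVec L r) : 𝔸ˣ) : 𝔸) - 1‖ ≤ α')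
  {δ : ℝ} (hδ : 0 ≤ δ) (hδmax : δ ≤ 1 / (12288 * ((2 * (d * L) + L + L : ℕ) : ℝ)))
  (hUδ : ∀ b : Bond d (fineP L m), ‖((U b : 𝔸ˣ) : 𝔸) * (((U' b)⁻¹ : 𝔸ˣ) : 𝔸) - 1‖ ≤ δ)

/-! ## §1 At a coarse bond: `Cblock U A − Cblock U′ A` -/

include hL hα' hU1' hreg' hδ hδmax hUδ in
/-- **THE BLOCK MAP `C₁(Lη·)` IS LIPSCHITZ IN THE BACKGROUND** at every coarse bond: `‖Cblock U A c − Cblock U′ A c‖ ≤ 150994944·(d+1)·L·N·δ·a` for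
`η·sup‖A‖ ≤ a ≤ c₃(d,L)∕4`, the base `U′` unit-bounded with `α′ ≤ 1∕128`-regular extended block loops and `‖U(b)U′(b)⁻¹ − 1‖ ≤ δ ≤ 1∕(12288N)` —
`Cblock = Qcov − linQcov` of the periodic extensions (`B7Prop3GeneralLinear.Ccov`), each half by this lineage's (G) (`norm_Qcov_sub_Qcov_le`, the Cauchy
estimate of [4] Prop. 7's analyticity in the background; `norm_linQcov_sub_linQcov_le`).
[cite: Balaban1985Variational, (44) p.285, (52) p.285; Balaban1985Averaging, (122)–(123) p.36, Proposition 7 p.43] -/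
theorem norm_Cblock_sub_Cblock_le (hη : 0 ≤ η) (A : Bond d (fineP L m) → 𝔸) {a : ℝ} (ha : 0 ≤ a) (hA : ∀ b, η * ‖A b‖ ≤ a)
    (hac : a ≤ c3 d L / 4) (c : Bond d m) :
    ‖Cblock L m η U A c - Cblock L m η U' A c‖ ≤ 150994944 * ((d : ℝ) + 1) * L * ((2 * (d * L) + L + L : ℕ) : ℝ) * δ * a := by
  have hAp : ∀ (x : B7Prop1Explicit.Site d) (κ : Fin d), ‖perCfg (fineP L m) ((η : ℂ) • A) x κ‖ ≤ a :=
    norm_perCfg_smul_le L m η hη A hA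
  have hUp : ∀ (x : B7Prop1Explicit.Site d) (κ : Fin d),
      ‖((perCfg (fineP L m) U x κ : 𝔸ˣ) : 𝔸) * (((perCfg (fineP L m) U' x κ)⁻¹ : 𝔸ˣ) : 𝔸) - 1‖ ≤ δ := fun x κ => hUδ _
  have h1 := norm_Qcov_sub_Qcov_le hL (V := perCfg (fineP L m) U) hU1' (cornerSite L c.1) c.2 hα' (hreg' c.1 c.2) hδ hδmax hUp
    (perCfg (fineP L m) ((η : ℂ) • A)) ha hAp hac
  have h2 := norm_linQcov_sub_linQcov_le hL (V := perCfg (fineP L m) U) hU1' (cornerSite L c.1) c.2 hα' (hreg' c.1 c.2) hδ hδmax hUp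
    (perCfg (fineP L m) ((η : ℂ) • A)) ha hAp
  simp only [Cblock_apply, Ccov]
  rw [sub_sub_sub_comm]
  refine (norm_sub_le _ _).trans ?_
  refine (add_le_add h1 h2).trans (le_of_eq ?_)
  ring

/-! ## §2 At the carrier: `Cc U Y − Cc U′ Y′` for two (115) spaces with the same underlying configuration -/

variable {κ' : Type*} [Fintype κ'] (lev₀ : Bond d (fineP L m) → ℕ) (lev₁ : κ' → ℕ)
  (Dc Dc' : (Bond d (fineP L m) → 𝔸) →ₗ[ℂ] (κ' → 𝔸)) (levB : Bond d m → ℕ) [Fact (0 < η)] [Fact (0 < (L : ℝ))] (hlev : ∀ b, 1 ≤ lev₀ b)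

include hL hα' hU1' hreg' hδ hδmax hUδ hlev in
/-- **THE LETTER `C` IS LIPSCHITZ IN THE BACKGROUND AT THE CARRIER**: for `Y ∈ Space115 … ∇`, `Y′ ∈ Space115 … ∇′` with the same underlying
configuration, `1 ≤ lev₀` and `‖Y‖_(115) < 1∕(512(d+1))` (so `η·sup‖Y‖ ≤ ‖Y‖∕L ≤ c₃∕4`, `B11Eq44COperatorTorus.eta_mul_norm_le_of_weight`):
`‖Cc U … Y − Cc U′ … Y′‖_(−0) ≤ 150994944·(d+1)·N·δ·‖Y‖` (§1 pointwise in the weight-`1` norm `|·|_(−0)`).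
[cite: Balaban1985Variational, (44) p.285, (51)–(52) p.285; Balaban1985Averaging, Proposition 7 p.43] -/
theorem norm_Cc_sub_Cc_le {Y : Space115 (L : ℝ) η lev₀ lev₁ Dc} {Y' : Space115 (L : ℝ) η lev₀ lev₁ Dc'}
    (hYY' : JetSup.equiv _ _ Dc' Y' = JetSup.equiv _ _ Dc Y) (hY : ‖Y‖ < 1 / (512 * ((d : ℝ) + 1))) :
    ‖Cc L m η U lev₀ lev₁ Dc levB Y - Cc L m η U' lev₀ lev₁ Dc' levB Y'‖ ≤
      150994944 * ((d : ℝ) + 1) * ((2 * (d * L) + L + L : ℕ) : ℝ) * δ * ‖Y‖ := by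
  have hL1 : (1 : ℝ) ≤ L := by exact_mod_cast hL
  have hL0 : (0 : ℝ) < L := lt_of_lt_of_le one_pos hL1
  have hηnn : 0 ≤ η := (Fact.out : 0 < η).le
  have ha : ∀ b, η * ‖JetSup.equiv _ _ Dc Y b‖ ≤ ‖Y‖ / L :=
    eta_mul_norm_le_of_weight L m η lev₀ hlev hL1 hηnn (JetSup.equiv _ _ Dc Y) (JetSup.weight_mul_norm_apply_le Y)
  have hac : ‖Y‖ / L ≤ c3 d L / 4 := by
    rw [c3, div_le_iff₀ hL0]
    have hpos : (0 : ℝ) < 128 * ((d : ℝ) + 1) * L := by positivity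
    have h1 : 1 / (128 * ((d : ℝ) + 1) * L) / 4 * L = 1 / (512 * ((d : ℝ) + 1)) := by field_simp; ring
    rw [h1]; exact hY.le
  -- (`positivity` on a goal carrying the (115) norm `‖Y‖` is a `whnf` blowup: split the sign by hand)
  have hK0 : (0 : ℝ) ≤ 150994944 * ((d : ℝ) + 1) * ((2 * (d * L) + L + L : ℕ) : ℝ) * δ := by positivity
  have hK : 0 ≤ 150994944 * ((d : ℝ) + 1) * ((2 * (d * L) + L + L : ℕ) : ℝ) * δ * ‖Y‖ := mul_nonneg hK0 (norm_nonneg Y)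
  refine (NegSup.norm_le_iff (w := levWeight (L : ℝ) η levB 0) (V := 𝔸) hK).2 fun c => ?_
  have e : NegSup.equiv (levWeight (L : ℝ) η levB 0) 𝔸 (Cc L m η U lev₀ lev₁ Dc levB Y - Cc L m η U' lev₀ lev₁ Dc' levB Y') c =
      Cblock L m η U (JetSup.equiv _ _ Dc Y) c - Cblock L m η U' (JetSup.equiv _ _ Dc Y) c := by
    rw [NegSup.equiv_sub, Pi.sub_apply, equiv_Cc_apply, equiv_Cc_apply, hYY']
  have hw : levWeight (L : ℝ) η levB 0 c = 1 := by rw [levWeight_apply, pow_zero]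
  rw [e, hw, one_mul]
  have h := norm_Cblock_sub_Cblock_le L m η U U' hL hα' hU1' hreg' hδ hδmax hUδ hηnn (JetSup.equiv _ _ Dc Y)
    (div_nonneg (norm_nonneg Y) hL0.le) ha hac c
  refine h.trans (le_of_eq ?_)
  have hLne : (L : ℝ) ≠ 0 := hL0.ne'
  calc 150994944 * ((d : ℝ) + 1) * L * ((2 * (d * L) + L + L : ℕ) : ℝ) * δ * (‖Y‖ / L)
        = 150994944 * ((d : ℝ) + 1) * ((2 * (d * L) + L + L : ℕ) : ℝ) * δ * ‖Y‖ * (L / L) := by ring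
      _ = 150994944 * ((d : ℝ) + 1) * ((2 * (d * L) + L + L : ℕ) : ℝ) * δ * ‖Y‖ := by rw [div_self hLne, mul_one]

include hL hα' hU1' hreg' hδ hδmax hUδ hlev in
/-- **… IN PARTICULAR ACROSS THE JET IDENTITY `ι_{∇_U→∇_{U′}}`** (which does not change the configuration):
`‖Cc U …(∇_U)… P − Cc U′ …(∇_{U′})… (ιP)‖ ≤ 150994944·(d+1)·N·δ·‖P‖` on `‖P‖ < 1∕(512(d+1))`. [cite: Balaban1985Variational, (44) p.285, (115) p.294, (117) p.295] -/
theorem norm_Cc_sub_Cc_jetId_le [FiniteDimensional ℂ 𝔸] (lev₁ : Bond d (fineP L m) × Fin d → ℕ) (P : Space115 (L : ℝ) η lev₀ lev₁ (nabla115 η U))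
    (hP : ‖P‖ < 1 / (512 * ((d : ℝ) + 1))) :
    ‖Cc L m η U lev₀ lev₁ (nabla115 η U) levB P -
        Cc L m η U' lev₀ lev₁ (nabla115 η U') levB
          (LinearMap.toContinuousLinearMap
            ((jetLinearEquiv (L : ℝ) η lev₀ lev₁ (nabla115 η U')).symm.toLinearMap ∘ₗ
              (jetLinearEquiv (L : ℝ) η lev₀ lev₁ (nabla115 η U)).toLinearMap) P)‖ ≤
      150994944 * ((d : ℝ) + 1) * ((2 * (d * L) + L + L : ℕ) : ℝ) * δ * ‖P‖ :=
  norm_Cc_sub_Cc_le L m η U U' hL hα' hU1' hreg' hδ hδmax hUδ lev₀ lev₁ (nabla115 η U) (nabla115 η U') levB hlev rfl hP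

include hL hα' hU1' hreg' hδ hδmax hUδ hlev in
/-- **THE `δ_C`-SLOT OF `B11Eq174ChartContinuityTwoBackgrounds.exists_chartHB_lipschitz_twoBackgrounds`, PRODUCED**: if the Sect. C radii satisfy
`ε_C + a_C ≤ 1∕(512(d+1))` then `∀ P, ‖P‖ < ε_C + a_C → ‖Cc U P − Cc U′ (ιP)‖ ≤ 150994944·(d+1)·N·δ·(ε_C + a_C)` — the displayed modulus with
`δ_C := 150994944(d+1)N·δ·(ε_C + a_C)`, linear in the backgrounds' distance. [cite: Balaban1985Variational, (44) p.285, (51)–(52) p.285, (174) p.305; Balaban1985Averaging, Proposition 7 p.43] -/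
theorem sectC_modulus_twoBackgrounds [FiniteDimensional ℂ 𝔸] (lev₁ : Bond d (fineP L m) × Fin d → ℕ) {εC aC : ℝ} (hcap : εC + aC ≤ 1 / (512 * ((d : ℝ) + 1))) :
    ∀ P : Space115 (L : ℝ) η lev₀ lev₁ (nabla115 η U), ‖P‖ < εC + aC →
      ‖Cc L m η U lev₀ lev₁ (nabla115 η U) levB P -
          Cc L m η U' lev₀ lev₁ (nabla115 η U') levB
            (LinearMap.toContinuousLinearMap
              ((jetLinearEquiv (L : ℝ) η lev₀ lev₁ (nabla115 η U')).symm.toLinearMap ∘ₗ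
                (jetLinearEquiv (L : ℝ) η lev₀ lev₁ (nabla115 η U)).toLinearMap) P)‖ ≤
        150994944 * ((d : ℝ) + 1) * ((2 * (d * L) + L + L : ℕ) : ℝ) * δ * (εC + aC) := fun P hP =>
  (norm_Cc_sub_Cc_jetId_le L m η U U' hL hα' hU1' hreg' hδ hδmax hUδ lev₀ levB hlev lev₁ P (hP.trans_le hcap)).trans
    (mul_le_mul_of_nonneg_left hP.le (by positivity))

end Literature.MathematicalPhysics.QuantumFieldTheory.Balaban1983to89.B11Eq44COperatorTwoBackgrounds

end
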